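import Literature.AnabelianGeometry.SemiGraphs.TemperedVanKampenConstantLevel
import HarnessLib

/-!
# Tempered van Kampen at CONSTANT coefficients: a compatible family of local homomorphisms `Φ_v : Π_v → G`, `Φ_e : Π_e → G`
# to a PROFINITE group induces a continuous `ρ : π₁^temp(H) → G` at EVERY chart, matching the verticial and edge homomorphisms
# up to conjugation ([SemiAnbd] Thm. 3.7 (i)/(iii) pp. 40–41; Rmk. 3.1.1 p. 33; Prop. 3.6 (iii) p. 38)

Mochizuki, *Semi-graphs of anabelioids*, Publ. RIMS **42** (2006), §3: Thm. 3.7 (i) p. 40 (verticial homomorphisms), (iii) p. 41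
(edge-like subgroups), Rmk. 3.1.1 p. 33 ("every profinite group is tempered" — completeness and separatedness of `G = lim G/N`),
Prop. 3.6 (iii) p. 38 (finite quotients of `π₁^temp(G)` from finite coverings)
[cite: MochizukiSemiAnbd2006, Thm 3.7(i) p.40] [cite: MochizukiSemiAnbd2006, Rmk 3.1.1 p.33].

PROOF-ONLY file (abc-iut cell, layer L3 [SemiAnbd], block-F seat abc-iut-f-169 gen 4; L3-lead g9 row
«TEMPERED-VAN-KAMPEN@CONSTANT-COEFFICIENTS» (ε3 GO 2026-08-27T11:39Z), SHAPES 2c8d0bf4a130457e FILE B — sequel of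
`TemperedVanKampenConstantLevel` (p529454: the level retractions `ρ_N : π₁^temp(H) → G/N`); 0 `def` · 0 `instance` · 0 notation ·
0 `Prop` fact · 0 `sorry`).

## What is proved
* ★ `HomToGroup.exists_hom_eq_on` / `HomToGroup.exists_hom` — for `Φ : HomToGroup H G` (p525155), `G` compact and totally disconnected, `H` as in Prop. 3.6, and
  EVERY chart `c` of `π₁^temp(H)`: a continuous homomorphism `ρ : π₁^temp(H) = c.G → G` with `ρ ∘ ψ_v = k_v Φ_v k_v⁻¹` for every
  vertex `v` and verticial `ψ_v`, and `ρ ∘ ψ_e = k_e Φ_e k_e⁻¹` for every edge `e` and edge homomorphism `ψ_e`; in the `_eq_on`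
  form `ρ` is NORMALISED at a chosen verticial `ψ₀`: `ρ ∘ ψ₀ = Φ_{v₀}` on the nose.  PROOF: the level
  retractions of the companion file, read through ONE natural identification family `e_N : G/N ≃ c(Φ^*(G/N))` at a base vertex
  (`exists_levelHom_of_equiv`), are COMPATIBLE along `G/N → G/M` (naturality of the family along `Φ^*(proj)`, equivariance of
  `c(Φ^*(proj))`); `ρ(x)` is the unique element of `G` with `ρ(x) N = ρ_N(x)` for all `N` (`IsTempered.of_profinite`: completeness +
  separatedness); it is a homomorphism by uniqueness and continuous because `ρ⁻¹(N) ⊇ ker ρ_N`; the conjugators `k`, a priori one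
  per level, are made uniform by compactness of `G` (the sets of level-`N` conjugators are closed, nonempty and directed).
* `HomToGroup.exists_hom_of_commute` — commutative `G` (compatible families of local CHARACTERS): `ρ ∘ ψ_v = Φ_v`,
  `ρ ∘ ψ_e = Φ_e` on the nose.

This is the «kill the graph» retraction of abc-iut-f-176 gen 6's memo (FINDING-hostable-types-residual §3/§6 (ii)) as an actual
continuous homomorphism out of the ABSTRACT tempered fundamental group, for every compatible family of local homomorphisms — the
G-constant case of the L3 row «TEMPERED-VAN-KAMPEN-QUOTIENT» («compatible vertex quotients ⇒ `Π^tp_𝔾 → π₁(𝔔)`»); the full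
statement with stable letters (target the `π₁` of a finite graph of finite groups) is NOT claimed.  Consumers: every argument that
needs a character / fold / finite quotient of `π₁^temp(H)` with prescribed local behaviour (abc-iut-f-176's separation tests
`not_exists_edgeLike_ge_of_character/_of_separated`, the translation characters of the abc-iut-L3-t8 lineage, (R3) of Cor. 3.9).

Binder census: structural data + `Prop36Hypotheses H` + `[CompactSpace G] [TotallyDisconnectedSpace G]` (+ commutativity in the
corollary); FACT 0 · GAP 0 · smuggled 0.  Honest framing: a universal property PROVED for the tree's own charts; nothing here takes a
side on [IUTchIII] Cor. 3.12; typed ≠ proved for anything of the IUT series; nothing asserts that abc is proved or refuted.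
-/

namespace Literature.AnabelianGeometry.SemiGraphs

namespace ProfiniteSemiGraph

open CategoryTheory Topology
open Literature.AlgebraicGeometry.Frobenioids.QuasiTemperoid.BTempConnected (hom_ρ ρ_one_apply ρ_mul_apply)

universe u

variable {ℋ : ProfiniteSemiGraph.{u}}

namespace HomToGroup

variable {G : Type u} [Group G] [TopologicalSpace G] [IsTopologicalGroup G] (Φ : HomToGroup ℋ G)


/-- **Tempered van Kampen at constant coefficients (profinite `G`).**  For a compatible family `Φ : HomToGroup H G` of continuous
local homomorphisms to a compact totally disconnected group `G` and every chart `c` of `π₁^temp(H)` (`H` as in Prop. 3.6), there is a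
continuous homomorphism `ρ : π₁^temp(H) → G` whose composite with every verticial homomorphism `ψ_v` (resp. edge homomorphism `ψ_e`)
is `Φ_v` (resp. `Φ_e`) up to conjugation in `G`.  (Assembly of the level retractions `ρ_N` read through ONE natural identification
family: they are compatible along `G/N → G/M`, so `ρ` exists by completeness and separatedness of the profinite `G` (Rmk. 3.1.1); the
conjugators are made uniform in `N` by compactness.) [cite: MochizukiSemiAnbd2006, Thm 3.7(i) p.40] -/
theorem exists_hom_eq_on [CompactSpace G] [TotallyDisconnectedSpace G] (h36 : ℋ.Prop36Hypotheses) (c : TemperedPiChart ℋ)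
    {v₀ : ℋ.graph.Vertex} {ψ₀ : ℋ.Gv v₀ →ₜ* c.G} (hψ₀ : IsVerticialHom c v₀ ψ₀) :
    ∃ ρ : c.G →ₜ* G,
      (∀ γ : ℋ.Gv v₀, ρ (ψ₀ γ) = Φ.fv v₀ γ) ∧
      (∀ (v : ℋ.graph.Vertex) (ψ : ℋ.Gv v →ₜ* c.G), IsVerticialHom c v ψ →
        ∃ k : G, ∀ γ : ℋ.Gv v, ρ (ψ γ) = k * Φ.fv v γ * k⁻¹) ∧
      ∀ (e : ℋ.graph.Edge) (ψ : ℋ.Ge e →ₜ* c.G), IsEdgeHom c e ψ →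
        ∃ k : G, ∀ γ : ℋ.Ge e, ρ (ψ γ) = k * Φ.fe e γ * k⁻¹ := by
  classical
  have hG : IsTempered G := IsTempered.of_profinite
  haveI hfin : ∀ N : OpenNormalSubgroup G, Finite (BTemp.Q hG N).obj.V :=
    fun N => inferInstanceAs (Finite (G ⧸ N.toSubgroup))
  -- ONE natural identification family for all coverings, at the base vertex
  obtain ⟨ε, hερ, hεδ⟩ := hψ₀.exists_equiv_natural_family
  -- the identifications `e_N : G/N ≃ c(Φ^*(G/N))` at the base vertex
  let e : ∀ N : OpenNormalSubgroup G,
      (G ⧸ N.toSubgroup) ≃ (c.equiv.functor.obj (Φ.pullbackTemp h36 (BTemp.Q hG N))).obj.V :=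
    fun N => ε (Φ.pullbackTemp h36 (BTemp.Q hG N))
  have he : ∀ (N : OpenNormalSubgroup G) (g : G) (q : G ⧸ N.toSubgroup),
      e N (q * (g : G ⧸ N.toSubgroup)) =
        (c.equiv.functor.map (Φ.pullbackTempMap h36 (BTemp.rightMul hG N g))).hom.hom.hom (e N q) :=
    fun N g q => by
      have := hεδ _ _ (Φ.pullbackTempMap h36 (BTemp.rightMul hG N g)) q
      erw [pullback_rightMul_fV_apply] at this
      exact this
  -- naturality along `G/N → G/M`
  have hp : ∀ (N M : OpenNormalSubgroup G) (hNM : N ≤ M) (z : G), e M (z : G ⧸ M.toSubgroup) =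
      (c.equiv.functor.map (Φ.pullbackTempMap h36 (BTemp.proj hG hNM))).hom.hom.hom (e N (z : G ⧸ N.toSubgroup)) :=
    fun N M hNM z => by
      have := hεδ _ _ (Φ.pullbackTempMap h36 (BTemp.proj hG hNM)) (z : G ⧸ N.toSubgroup)
      erw [pullback_map_fV_apply, BTemp.proj_apply] at this
      exact this
  -- the level retractions, characterised
  choose ρN hρN using fun N => Φ.exists_levelHom_of_equiv hG h36 N c (e N) (he N)
  have hρN1 : ∀ (N : OpenNormalSubgroup G) (x : c.G),
      (c.equiv.functor.obj (Φ.pullbackTemp h36 (BTemp.Q hG N))).obj.ρ x (e N ((1 : G) : G ⧸ N.toSubgroup)) =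
        e N (ρN N x) := fun N x => by
    apply (e N).symm.injective
    rw [Equiv.symm_apply_apply, hρN N x 1, QuotientGroup.mk_one, mul_one]
  -- compatibility along `G/N → G/M`
  have hcompat : ∀ (N M : OpenNormalSubgroup G) (hNM : N ≤ M) (x : c.G) (g : G),
      ρN N x = (g : G ⧸ N.toSubgroup) → ρN M x = (g : G ⧸ M.toSubgroup) := by
    intro N M hNM x g hg
    apply (e M).injective
    rw [← hρN1 M x, hp N M hNM 1]
    erw [← hom_ρ (c.equiv.functor.map (Φ.pullbackTempMap h36 (BTemp.proj hG hNM))) x]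
    rw [hρN1 N x, hg, ← hp N M hNM g]
  -- the limit element
  have hex : ∀ x : c.G, ∃ g : G, ∀ N : OpenNormalSubgroup G, ρN N x = (g : G ⧸ N.toSubgroup) := fun x =>
    hG.complete (fun N => ρN N x) (fun N M hNM g hg => hcompat N M hNM x g hg)
  choose ρf hρf using hex
  have huniq : ∀ (x : c.G) (g : G), (∀ N : OpenNormalSubgroup G, ρN N x = (g : G ⧸ N.toSubgroup)) → g = ρf x := by
    intro x g hg
    by_contra hne
    obtain ⟨N, hN⟩ := hG.separated (g⁻¹ * ρf x) (fun h1 => hne (inv_mul_eq_one.mp h1))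
    apply hN
    have := (hg N).symm.trans (hρf x N)
    rw [QuotientGroup.eq] at this
    exact this
  -- `ρf` is a group homomorphism
  have hmul : ∀ x y : c.G, ρf (x * y) = ρf x * ρf y := fun x y =>
    (huniq (x * y) (ρf x * ρf y) fun N => by rw [map_mul, hρf x N, hρf y N, QuotientGroup.mk_mul]).symm
  have hone : ρf 1 = 1 := (huniq 1 1 fun N => by rw [map_one, QuotientGroup.mk_one]).symm
  let ρm : c.G →* G := { toFun := ρf, map_one' := hone, map_mul' := hmul }
  -- continuity: `ρ⁻¹(N) ⊇ ker ρ_N` for every open normal `N`, and these form a basis of neighbourhoods of `1`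
  have hcont : Continuous ρm := by
    refine continuous_of_continuousAt_one ρm ?_
    rw [ContinuousAt, map_one]
    refine tendsto_nhds.mpr fun U hU h1 => ?_
    obtain ⟨V, hVU, hVo, h1V⟩ := mem_nhds_iff.mp (hU.mem_nhds h1)
    obtain ⟨N, hN⟩ := ProfiniteGrp.exist_openNormalSubgroup_sub_open_nhds_of_one hVo h1V
    have hker : IsOpen ((ρN N) ⁻¹' {1}) := (isOpen_discrete _).preimage (ρN N).continuous
    refine Filter.mem_of_superset (hker.mem_nhds (by simp)) fun x hx => hVU (hN ?_)
    have hx1 : ρN N x = 1 := hx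
    have := hρf x N
    rw [hx1, eq_comm, QuotientGroup.eq_one_iff] at this
    exact this
  -- conjugators uniform in `N`, by compactness
  have hconj : ∀ {P : Type u} [Group P] (χ : P →* c.G) (a : P →* G),
      (∀ N : OpenNormalSubgroup G, ∃ k : G, ∀ γ : P, ρN N (χ γ) = ((k * a γ * k⁻¹ : G) : G ⧸ N.toSubgroup)) →
      ∃ k : G, ∀ γ : P, ρf (χ γ) = k * a γ * k⁻¹ := by
    intro P _ χ a hN
    let K : OpenNormalSubgroup G → Set G := fun N =>
      {k : G | ∀ γ : P, ρN N (χ γ) = ((k * a γ * k⁻¹ : G) : G ⧸ N.toSubgroup)}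
    have hKne : ∀ N, (K N).Nonempty := fun N => hN N
    have hKcl : ∀ N, IsClosed (K N) := fun N => by
      have : K N = ⋂ γ : P, (fun k : G => ((k * a γ * k⁻¹ : G) : G ⧸ N.toSubgroup)) ⁻¹' {ρN N (χ γ)} := by
        ext k; simp [K, Set.mem_iInter, eq_comm]
      rw [this]
      refine isClosed_iInter fun γ => IsClosed.preimage ?_ (isClosed_discrete _)
      exact QuotientGroup.continuous_mk.comp (by fun_prop)
    have hKdir : Directed (· ⊇ ·) K := fun N M => ⟨N ⊓ M,
      fun k hk γ => hcompat (N ⊓ M) N inf_le_left (χ γ) _ (hk γ),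
      fun k hk γ => hcompat (N ⊓ M) M inf_le_right (χ γ) _ (hk γ)⟩
    haveI : Nonempty (OpenNormalSubgroup G) := ⟨⟨⟨⊤, isOpen_univ⟩, inferInstance⟩⟩
    obtain ⟨k, hk⟩ := IsCompact.nonempty_iInter_of_directed_nonempty_isCompact_isClosed K hKdir hKne
      (fun N => (hKcl N).isCompact) hKcl
    exact ⟨k, fun γ => (huniq (χ γ) (k * a γ * k⁻¹) fun N => (Set.mem_iInter.mp hk N) γ).symm⟩
  refine ⟨⟨ρm, hcont⟩, fun γ => ?_, fun v ψ hψ => ?_, fun e' ψ hψ => ?_⟩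
  · -- at the base vertex the identification is `ψ₀`-equivariant: `ρ_N (ψ₀ γ) = Φ_{v₀} γ · N` on the nose
    refine (huniq (ψ₀ γ) (Φ.fv v₀ γ) fun N => ?_).symm
    apply (e N).injective
    rw [← hρN1 N]
    have := hερ (Φ.pullbackTemp h36 (BTemp.Q hG N)) γ ((1 : G) : G ⧸ N.toSubgroup)
    erw [pullback_Q_ρV_apply] at this
    rw [mul_one] at this
    exact this.symm
  · refine hconj ψ.toMonoidHom (Φ.fv v).toMonoidHom fun N => ?_
    obtain ⟨εv, hεvρ, hεvδ⟩ := hψ.exists_equiv_natural_family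
    obtain ⟨k, hk⟩ := Φ.symm_ρ_apply_eq_conj hG h36 N c ψ.toMonoidHom (Φ.fv v).toMonoidHom (e N)
      (εv (Φ.pullbackTemp h36 (BTemp.Q hG N))) (he N)
      (fun g q => by
        have := hεvδ _ _ (Φ.pullbackTempMap h36 (BTemp.rightMul hG N g)) q
        erw [pullback_rightMul_fV_apply] at this
        exact this)
      (fun γ z => by
        have := hεvρ (Φ.pullbackTemp h36 (BTemp.Q hG N)) γ (z : G ⧸ N.toSubgroup)
        erw [pullback_Q_ρV_apply] at this
        exact this)
    refine ⟨k, fun γ => ?_⟩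
    rw [← hk γ, hρN1 N, Equiv.symm_apply_apply]
  · refine hconj ψ.toMonoidHom (Φ.fe e').toMonoidHom fun N => ?_
    obtain ⟨εe, hεeρ, hεeδ⟩ := hψ.exists_equiv_natural_family
    obtain ⟨k, hk⟩ := Φ.symm_ρ_apply_eq_conj hG h36 N c ψ.toMonoidHom (Φ.fe e').toMonoidHom (e N)
      (εe (Φ.pullbackTemp h36 (BTemp.Q hG N))) (he N)
      (fun g q => by
        have := hεeδ _ _ (Φ.pullbackTempMap h36 (BTemp.rightMul hG N g)) q
        erw [pullback_rightMul_fE_apply] at this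
        exact this)
      (fun γ z => by
        have := hεeρ (Φ.pullbackTemp h36 (BTemp.Q hG N)) γ (z : G ⧸ N.toSubgroup)
        erw [pullback_Q_ρE_apply] at this
        exact this)
    refine ⟨k, fun γ => ?_⟩
    rw [← hk γ, hρN1 N, Equiv.symm_apply_apply]

/-- **Tempered van Kampen at constant coefficients (profinite `G`)** — the form without a distinguished base vertex: `ρ` matches
EVERY verticial and edge homomorphism up to conjugation. [cite: MochizukiSemiAnbd2006, Thm 3.7(i) p.40] -/
theorem exists_hom [CompactSpace G] [TotallyDisconnectedSpace G] (h36 : ℋ.Prop36Hypotheses) (c : TemperedPiChart ℋ) :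
    ∃ ρ : c.G →ₜ* G,
      (∀ (v : ℋ.graph.Vertex) (ψ : ℋ.Gv v →ₜ* c.G), IsVerticialHom c v ψ →
        ∃ k : G, ∀ γ : ℋ.Gv v, ρ (ψ γ) = k * Φ.fv v γ * k⁻¹) ∧
      ∀ (e : ℋ.graph.Edge) (ψ : ℋ.Ge e →ₜ* c.G), IsEdgeHom c e ψ →
        ∃ k : G, ∀ γ : ℋ.Ge e, ρ (ψ γ) = k * Φ.fe e γ * k⁻¹ := by
  obtain ⟨v₀⟩ := h36.hasVertex
  obtain ⟨H₀, hH₀⟩ := nonempty_verticialSubgroups h36 c v₀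
  obtain ⟨ψ₀, hψ₀, -⟩ := (mem_verticialSubgroups_iff_exists_isVerticialHom c v₀ H₀).mp hH₀
  obtain ⟨ρ, -, hV, hE⟩ := Φ.exists_hom_eq_on h36 c hψ₀
  exact ⟨ρ, hV, hE⟩

/-- **Characters: commutative `G`.**  If `G` is commutative (e.g. an abelian profinite group of values of a compatible family of
local CHARACTERS), the conjugation disappears: `ρ ∘ ψ_v = Φ_v` and `ρ ∘ ψ_e = Φ_e` ON THE NOSE for every verticial / edge
homomorphism at every chart — the tempered group's character with prescribed local restrictions.
[cite: MochizukiSemiAnbd2006, Thm 3.7(i) p.40] -/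
theorem exists_hom_of_commute [CompactSpace G] [TotallyDisconnectedSpace G] (hcomm : ∀ a b : G, Commute a b)
    (h36 : ℋ.Prop36Hypotheses) (c : TemperedPiChart ℋ) :
    ∃ ρ : c.G →ₜ* G,
      (∀ (v : ℋ.graph.Vertex) (ψ : ℋ.Gv v →ₜ* c.G), IsVerticialHom c v ψ → ∀ γ : ℋ.Gv v, ρ (ψ γ) = Φ.fv v γ) ∧
      ∀ (e : ℋ.graph.Edge) (ψ : ℋ.Ge e →ₜ* c.G), IsEdgeHom c e ψ → ∀ γ : ℋ.Ge e, ρ (ψ γ) = Φ.fe e γ := by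
  obtain ⟨ρ, hV, hE⟩ := Φ.exists_hom h36 c
  refine ⟨ρ, fun v ψ hψ γ => ?_, fun e ψ hψ γ => ?_⟩
  · obtain ⟨k, hk⟩ := hV v ψ hψ
    rw [hk γ, (hcomm k (Φ.fv v γ)).eq, mul_inv_cancel_right]
  · obtain ⟨k, hk⟩ := hE e ψ hψ
    rw [hk γ, (hcomm k (Φ.fe e γ)).eq, mul_inv_cancel_right]

end HomToGroup

end ProfiniteSemiGraph

end Literature.AnabelianGeometry.SemiGraphs
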